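import Mathlib
import HarnessLib

/-!
# Stub `stub_productLowerBound` (line `Sketch`, crux `KineticLatticeBEC`, stmt-AtomisticToContinuum-9671)

Pure real analysis. For `0 ≤ K`, `0 < V`, `4K² ≤ V`, `2N ≤ V`, with `δ_i = K/√(V(i+1))`:
every `δ_i` lies in `[0, ½]` (since `√(V(i+1)) ≥ √V ≥ 2K`), hence `1 − δ_i ∈ [0, 1]`; and
`e^{−2√2·K} ≤ Π_{i<N} (1 − δ_i)`, from the factorwise bound `e^{−2δ} ≤ 1 − δ` on `[0, ½]`
(via `1 − x⁻¹ ≤ log x`), `Π e^{−2δ_i} = e^{−2Σδ_i}`, the harmonic-type estimate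
`Σ_{i<N} 1/√(i+1) ≤ 2√N` (telescoping `1/√(n+1) ≤ 2(√(n+1) − √n)`), and `2√N ≤ √2·√V`.
-/

noncomputable section

namespace Summit.AtomisticToContinuum.BoseEinsteinCondensation.Cruxes.KineticLatticeBEC.SectorLadder

open scoped BigOperators

/-- **Factorwise bound.** For `0 ≤ δ ≤ ½`: `e^{−2δ} ≤ 1 − δ` (from `1 − (1−δ)⁻¹ ≤ log(1−δ)` and
`(1−δ)⁻¹ ≤ 1 + 2δ`). [folklore] -/
theorem exp_neg_two_mul_le_one_sub {δ : ℝ} (h0 : 0 ≤ δ) (h1 : δ ≤ 1 / 2) :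
    Real.exp (-(2 * δ)) ≤ 1 - δ := by
  have hpos : 0 < 1 - δ := by linarith
  have hinv : 1 / (1 - δ) ≤ 1 + 2 * δ := by
    rw [div_le_iff₀ hpos]
    nlinarith
  have hlog : 1 - (1 - δ)⁻¹ ≤ Real.log (1 - δ) := Real.one_sub_inv_le_log_of_pos hpos
  rw [← one_div] at hlog
  calc Real.exp (-(2 * δ)) ≤ Real.exp (Real.log (1 - δ)) := Real.exp_le_exp.2 (by linarith)
    _ = 1 - δ := Real.exp_log hpos

/-- **Harmonic-type estimate.** `Σ_{i<N} 1/√(i+1) ≤ 2√N`, by induction on `N` using the telescoping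
step `1/√(n+1) ≤ 2(√(n+1) − √n)`. [folklore] -/
theorem sum_inv_sqrt_succ_le (N : ℕ) :
    ∑ i ∈ Finset.range N, 1 / Real.sqrt ((i : ℝ) + 1) ≤ 2 * Real.sqrt (N : ℝ) := by
  induction N with
  | zero => simp
  | succ n ih =>
    rw [Finset.sum_range_succ]
    have hb : 0 < Real.sqrt ((n : ℝ) + 1) := Real.sqrt_pos.2 (by positivity)
    have hb2 : Real.sqrt ((n : ℝ) + 1) ^ 2 = (n : ℝ) + 1 := Real.sq_sqrt (by positivity)
    have ha2 : Real.sqrt (n : ℝ) ^ 2 = (n : ℝ) := Real.sq_sqrt (Nat.cast_nonneg n)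
    have hstep :
        1 / Real.sqrt ((n : ℝ) + 1) ≤ 2 * (Real.sqrt ((n : ℝ) + 1) - Real.sqrt (n : ℝ)) := by
      rw [div_le_iff₀ hb]
      nlinarith [sq_nonneg (Real.sqrt ((n : ℝ) + 1) - Real.sqrt (n : ℝ))]
    push_cast
    linarith

/-- **Stub C — product lower bound.** For `0 ≤ K`, `4K² ≤ V`, `2N ≤ V`: every factor
`1 − K/√(V(i+1))`, `i < N`, lies in `[0, 1]` and `e^{−2√2·K} ≤ Π_{i<N} (1 − K/√(V(i+1)))`
(`e^{−2δ} ≤ 1 − δ` for `δ ∈ [0, ½]`, `Σ_{i<N} 1/√(i+1) ≤ 2√N ≤ √2·√V`). [folklore] -/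
theorem stub_productLowerBound (K V : ℝ) (hK : 0 ≤ K) (hV : 0 < V) (hKV : 4 * K ^ 2 ≤ V) (N : ℕ)
    (hN : 2 * (N : ℝ) ≤ V) :
    (∀ i ∈ Finset.range N,
        0 ≤ 1 - K / Real.sqrt (V * ((i : ℝ) + 1)) ∧ 1 - K / Real.sqrt (V * ((i : ℝ) + 1)) ≤ 1) ∧
      Real.exp (-(2 * Real.sqrt 2 * K)) ≤
        ∏ i ∈ Finset.range N, (1 - K / Real.sqrt (V * ((i : ℝ) + 1))) := by
  have hs : 0 < Real.sqrt V := Real.sqrt_pos.2 hV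
  have h2K : 2 * K ≤ Real.sqrt V := Real.le_sqrt_of_sq_le (by nlinarith [hKV])
  -- every `δ_i = K/√(V(i+1))` lies in `[0, ½]`
  have hδ : ∀ i : ℕ, 0 ≤ K / Real.sqrt (V * ((i : ℝ) + 1)) ∧
      K / Real.sqrt (V * ((i : ℝ) + 1)) ≤ 1 / 2 := by
    intro i
    have hmono : Real.sqrt V ≤ Real.sqrt (V * ((i : ℝ) + 1)) :=
      Real.sqrt_le_sqrt (le_mul_of_one_le_right hV.le (by linarith [(Nat.cast_nonneg i : (0 : ℝ) ≤ i)]))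
    have hpos : 0 < Real.sqrt (V * ((i : ℝ) + 1)) := lt_of_lt_of_le hs hmono
    refine ⟨div_nonneg hK (Real.sqrt_nonneg _), ?_⟩
    rw [div_le_iff₀ hpos]
    linarith
  refine ⟨fun i _ => ⟨by linarith [(hδ i).2], by linarith [(hδ i).1]⟩, ?_⟩
  -- `2√N ≤ √2·√V` from `2N ≤ V`
  have h2t : 2 * Real.sqrt (N : ℝ) ≤ Real.sqrt 2 * Real.sqrt V := by
    rw [← Real.sqrt_mul zero_le_two]
    exact Real.le_sqrt_of_sq_le (by nlinarith [Real.sq_sqrt (Nat.cast_nonneg N), hN])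
  -- `Σ δ_i = (K/√V) Σ 1/√(i+1) ≤ (K/√V)·2√N ≤ √2·K`
  have hsum_eq : ∑ i ∈ Finset.range N, K / Real.sqrt (V * ((i : ℝ) + 1)) =
      K / Real.sqrt V * ∑ i ∈ Finset.range N, 1 / Real.sqrt ((i : ℝ) + 1) := by
    rw [Finset.mul_sum]
    refine Finset.sum_congr rfl fun i _ => ?_
    rw [Real.sqrt_mul hV.le, div_mul_div_comm, mul_one]
  have hsum : ∑ i ∈ Finset.range N, K / Real.sqrt (V * ((i : ℝ) + 1)) ≤ Real.sqrt 2 * K := by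
    rw [hsum_eq]
    have h1 : K / Real.sqrt V * ∑ i ∈ Finset.range N, 1 / Real.sqrt ((i : ℝ) + 1) ≤
        K / Real.sqrt V * (2 * Real.sqrt (N : ℝ)) :=
      mul_le_mul_of_nonneg_left (sum_inv_sqrt_succ_le N) (div_nonneg hK hs.le)
    have h2 : K / Real.sqrt V * (2 * Real.sqrt (N : ℝ)) ≤ Real.sqrt 2 * K := by
      rw [div_mul_eq_mul_div, div_le_iff₀ hs]
      nlinarith [mul_le_mul_of_nonneg_left h2t hK]
    linarith
  calc Real.exp (-(2 * Real.sqrt 2 * K))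
      ≤ Real.exp (-(2 * ∑ i ∈ Finset.range N, K / Real.sqrt (V * ((i : ℝ) + 1)))) :=
        Real.exp_le_exp.2 (by linarith [hsum])
    _ = ∏ i ∈ Finset.range N, Real.exp (-(2 * (K / Real.sqrt (V * ((i : ℝ) + 1))))) := by
        rw [Finset.mul_sum, ← Finset.sum_neg_distrib, Real.exp_sum]
    _ ≤ ∏ i ∈ Finset.range N, (1 - K / Real.sqrt (V * ((i : ℝ) + 1))) :=
        Finset.prod_le_prod (fun i _ => (Real.exp_pos _).le)
          (fun i _ => exp_neg_two_mul_le_one_sub (hδ i).1 (hδ i).2)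

end Summit.AtomisticToContinuum.BoseEinsteinCondensation.Cruxes.KineticLatticeBEC.SectorLadder
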